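import Mathlib
import HarnessLib
import Literature.MathematicalPhysics.QuantumLattice.GaugeGroups
import Literature.MathematicalPhysics.QuantumLattice.LatticeGaugeDLRProofs
import Literature.MathematicalPhysics.QuantumFieldTheory.ConstructiveQFTWave0
import Summits.Ventures.LatticeQCDFlow.Exactness.FlowPushforward
import Summits.Ventures.LatticeQCDFlow.Scaling.LatticeEntropySUN
import Summits.Ventures.LatticeQCDFlow.Scaling.EntropyBudgetLayers
import Summits.Ventures.LatticeQCDFlow.Scaling.EntropyBudgetCoupling
import Summits.Ventures.LatticeQCDFlow.Scaling.EntropyBudgetCouplingSUN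

/-!
# LatticeQCDFlow / Scaling — the entropy budget of an exact flow, VIII: Haar-isometric layers

HONEST FRAMING: exact (Metropolis-corrected) sampling algorithms for lattice gauge theory;
figures of merit are autocorrelation/cost numbers at stated couplings and volumes; no
continuum-physics claim.

Venture `LatticeQCDFlow` (cell pub-lqcd), topic `Scaling`, THEORY-2.md §3.2 (h) / §4 row T2-AI(m)
(theory seat GEN-10).  Two things about the architecture-form depth law
`SU2.depth_lower_bound_coupling` of Part VI:

1. ITS HYPOTHESES ARE INHABITED.  A measure-preserving map is an exact map with Jacobian `1`
   (`hasJacobian_one_of_measurePreserving`); in particular the two-sided translations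
   `g ↦ a·g·b⁻¹` of a compact group — the gauge-covariant "multiplicative" single-link updates —
   are exact for the Haar probability with Jacobian `1` (`hasJacobian_mul_mul_inv`, from
   `QuantumLattice.measurePreserving_mul_mul_inv_haarProbability`).  So the per-link exactness
   hypothesis of Part VI is met, with clamp `ℓ = 0`, by every architecture whose single-link maps
   preserve Haar measure.

2. A NO-GO.  For such HAAR-ISOMETRIC architectures the depth law degenerates to a bound that no
   depth can improve: `SU2.no_capacity_of_measurePreserving` — for every `n`, every choice of active
   links and every family of frozen-dependent Haar-preserving single-link bijections, an exact
   `SU(2)` sampler with prior density `≤ M` keeping `ESS ≥ e^{−t}` at `β ≥ 1` on `L^d` must have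
   `log M ≥ 3((d−1)L^d(1/2 − 1/L) − 1/2)·log β − c·L^d − t`; with the Haar prior (`M = 1`) this says
   `ESS ≤ e^{c·L^d}·β^{−3((d−1)L^d(1/2 − 1/L) − 1/2)}` WHATEVER THE DEPTH.  All the capacity of a
   coupling flow sits in the per-link volume distortion `ℓ`; depth without distortion buys nothing.
   `SUN.no_capacity_of_measurePreserving_of` is the `SU(N)` form given `SUN.EntropyGrowthLaw d N`.

References as in Parts III–VII. [folklore]
-/

noncomputable section

namespace Summit.Ventures.LatticeQCDFlow.Theory2

open MeasureTheory Summit.Ventures.LatticeQCDFlow.Exactness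
open Literature.MathematicalPhysics.QuantumLattice Literature.MathematicalPhysics.QuantumFieldTheory
open scoped ENNReal

/-- A measure-preserving self-map is an exact map with Jacobian `1`. [folklore] -/
theorem hasJacobian_one_of_measurePreserving {Ω : Type*} [MeasurableSpace Ω] {vol : Measure Ω}
    {F : Ω → Ω} (hF : MeasurePreserving F vol vol) : HasJacobian vol F fun _ => 1 where
  measurable := hF.measurable
  measurable_jac := measurable_const
  map_eq := by
    have h : vol.withDensity (fun _ => (1 : ℝ≥0∞)) = vol := withDensity_one
    rw [h]
    exact hF.map_eq

/-- **The multiplicative single-link moves are exact with Jacobian `1`.**  On a compact group the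
two-sided translation `g ↦ a·g·b⁻¹` preserves the Haar probability (unimodularity;
`QuantumLattice.measurePreserving_mul_mul_inv_haarProbability`), hence is an exact map of
`haarProbability G` with Jacobian `1` — the per-link hypothesis of `SU2.depth_lower_bound_coupling`
with clamp `ℓ = 0`. [folklore] -/
theorem hasJacobian_mul_mul_inv {G : Type*} [Group G] [TopologicalSpace G] [IsTopologicalGroup G]
    [CompactSpace G] [MeasurableSpace G] [BorelSpace G] (a b : G) :
    HasJacobian (haarProbability G) (fun g => a * g * b⁻¹) fun _ => 1 :=
  hasJacobian_one_of_measurePreserving (measurePreserving_mul_mul_inv_haarProbability a b)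

end Summit.Ventures.LatticeQCDFlow.Theory2

namespace Summit.Ventures.LatticeQCDFlow.Theory2.Lattice

open MeasureTheory Summit.Ventures.LatticeQCDFlow.Exactness
open Literature.MathematicalPhysics.QuantumLattice Literature.MathematicalPhysics.QuantumFieldTheory
open scoped ENNReal

/-- **NO-GO: Haar-isometric coupling architectures carry no capacity (`SU(2)`, unconditional).**
`∃ c = c(d)`: for all `L ≥ 2`, `β ≥ 1`, every depth `n`, every choice of active links `P k` and
every family `Ψ k a (U|frozen) : SU(2) ≃ᵐ SU(2)` of frozen-dependent single-link bijections that
PRESERVE the Haar probability (jointly measurable with their inverses), every prior density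
`0 < r ≤ M`: if the exact sampler `layersEquiv (coupleEquiv (Ψ k) …)ₖ` pushed from `r·Haar^{⊗E}`
keeps `ESS ≥ e^{−t}` against the `SU(2)` Wilson law at `β`, then
`3((d−1)L^d(1/2 − 1/L) − 1/2)·log β − c·L^d − t ≤ log M` — independent of `n`.
(`SU2.depth_lower_bound_coupling` at `Jf ≡ 1`, `ℓ = 0`.) [folklore] -/
theorem SU2.no_capacity_of_measurePreserving (d : ℕ) :
    ∃ c : ℝ, ∀ (L : ℕ) [NeZero L], 2 ≤ L → ∀ β : ℝ, 1 ≤ β →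
      ∀ (n : ℕ) (P : Fin n → Edge d L → Prop) [∀ k, DecidablePred (P k)]
        (Ψ : (k : Fin n) → {e // P k e} → ({e // ¬P k e} → Matrix.specialUnitaryGroup (Fin 2) ℂ) →
          Matrix.specialUnitaryGroup (Fin 2) ℂ ≃ᵐ Matrix.specialUnitaryGroup (Fin 2) ℂ)
        (hΨ : ∀ k a, Measurable fun q : Matrix.specialUnitaryGroup (Fin 2) ℂ ×
          ({e // ¬P k e} → Matrix.specialUnitaryGroup (Fin 2) ℂ) => Ψ k a q.2 q.1)
        (hΨs : ∀ k a, Measurable fun q : Matrix.specialUnitaryGroup (Fin 2) ℂ ×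
          ({e // ¬P k e} → Matrix.specialUnitaryGroup (Fin 2) ℂ) => (Ψ k a q.2).symm q.1)
        (r : GaugeConfig d L (Matrix.specialUnitaryGroup (Fin 2) ℂ) → ℝ) (M t : ℝ),
        (∀ k a y, MeasurePreserving (Ψ k a y)
          (haarProbability (Matrix.specialUnitaryGroup (Fin 2) ℂ))
          (haarProbability (Matrix.specialUnitaryGroup (Fin 2) ℂ))) →
        Measurable r → (∀ V, 0 < r V) → (∀ V, r V ≤ M) →
          Real.exp (-t) ≤ essM (wilsonMeasure (d := d) (L := L) (fundamentalRep (Fin 2)) β)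
              (Measure.map (layersEquiv (List.ofFn fun k =>
                  (coupleEquiv (Ψ k) (hΨ k) (hΨs k),
                    coupleJac (P k) fun _ _ _ => (1 : ℝ))))
                ((Measure.pi fun _ : Edge d L =>
                  haarProbability (Matrix.specialUnitaryGroup (Fin 2) ℂ)).withDensity
                  fun V => ENNReal.ofReal (r V))) →
            3 * (((d : ℝ) - 1) * (L : ℝ) ^ d * (1 / 2 - 1 / L) - 1 / 2) * Real.log β -
                c * (L : ℝ) ^ d - t ≤ Real.log M := by
  obtain ⟨c, hc⟩ := SU2.depth_lower_bound_coupling d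
  refine ⟨c, fun L _ hL β hβ n P _ Ψ hΨ hΨs r M t hmp hr hr0 hrM hess => ?_⟩
  have h := hc L hL β hβ n P Ψ (fun _ _ _ _ => (1 : ℝ)) hΨ hΨs r 0
    (Fintype.card (Edge d L)) M t (fun k a => measurable_const)
    (fun k a y => by
      simpa only [ENNReal.ofReal_one] using hasJacobian_one_of_measurePreserving (hmp k a y))
    (fun k a y g => one_pos) (fun k a y g => by norm_num) le_rfl
    (fun k => by exact_mod_cast Fintype.card_subtype_le (P k)) hr hr0 hrM hess
  simpa only [zero_mul, mul_zero, zero_add] using h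

/-- **The same no-go for `SU(N)`, given the item `SUN.EntropyGrowthLaw d N` (`1 ≤ N`):**
Haar-preserving single-link bijections, any depth ⟹
`(N²−1)((d−1)L^d(1/2 − 1/L) − 1/2)·log β − c·L^d − t ≤ log M`. [folklore] -/
theorem SUN.no_capacity_of_measurePreserving_of (d N : ℕ) (h : SUN.EntropyGrowthLaw d N)
    (hN : 1 ≤ N) :
    ∃ c : ℝ, ∀ (L : ℕ) [NeZero L], 2 ≤ L → ∀ β : ℝ, 1 ≤ β →
      ∀ (n : ℕ) (P : Fin n → Edge d L → Prop) [∀ k, DecidablePred (P k)]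
        (Ψ : (k : Fin n) → {e // P k e} → ({e // ¬P k e} → Matrix.specialUnitaryGroup (Fin N) ℂ) →
          Matrix.specialUnitaryGroup (Fin N) ℂ ≃ᵐ Matrix.specialUnitaryGroup (Fin N) ℂ)
        (hΨ : ∀ k a, Measurable fun q : Matrix.specialUnitaryGroup (Fin N) ℂ ×
          ({e // ¬P k e} → Matrix.specialUnitaryGroup (Fin N) ℂ) => Ψ k a q.2 q.1)
        (hΨs : ∀ k a, Measurable fun q : Matrix.specialUnitaryGroup (Fin N) ℂ ×
          ({e // ¬P k e} → Matrix.specialUnitaryGroup (Fin N) ℂ) => (Ψ k a q.2).symm q.1)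
        (r : GaugeConfig d L (Matrix.specialUnitaryGroup (Fin N) ℂ) → ℝ) (M t : ℝ),
        (∀ k a y, MeasurePreserving (Ψ k a y)
          (haarProbability (Matrix.specialUnitaryGroup (Fin N) ℂ))
          (haarProbability (Matrix.specialUnitaryGroup (Fin N) ℂ))) →
        Measurable r → (∀ V, 0 < r V) → (∀ V, r V ≤ M) →
          Real.exp (-t) ≤ essM (wilsonMeasure (d := d) (L := L) (fundamentalRep (Fin N)) β)
              (Measure.map (layersEquiv (List.ofFn fun k =>
                  (coupleEquiv (Ψ k) (hΨ k) (hΨs k),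
                    coupleJac (P k) fun _ _ _ => (1 : ℝ))))
                ((Measure.pi fun _ : Edge d L =>
                  haarProbability (Matrix.specialUnitaryGroup (Fin N) ℂ)).withDensity
                  fun V => ENNReal.ofReal (r V))) →
            ((N : ℝ) ^ 2 - 1) * (((d : ℝ) - 1) * (L : ℝ) ^ d * (1 / 2 - 1 / L) - 1 / 2) *
                Real.log β - c * (L : ℝ) ^ d - t ≤ Real.log M := by
  obtain ⟨c, hc⟩ := SUN.depth_lower_bound_coupling_of d N h hN
  refine ⟨c, fun L _ hL β hβ n P _ Ψ hΨ hΨs r M t hmp hr hr0 hrM hess => ?_⟩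
  have h := hc L hL β hβ n P Ψ (fun _ _ _ _ => (1 : ℝ)) hΨ hΨs r 0
    (Fintype.card (Edge d L)) M t (fun k a => measurable_const)
    (fun k a y => by
      simpa only [ENNReal.ofReal_one] using hasJacobian_one_of_measurePreserving (hmp k a y))
    (fun k a y g => one_pos) (fun k a y g => by norm_num) le_rfl
    (fun k => by exact_mod_cast Fintype.card_subtype_le (P k)) hr hr0 hrM hess
  simpa only [zero_mul, mul_zero, zero_add] using h

end Summit.Ventures.LatticeQCDFlow.Theory2.Lattice

end
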